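import Summits.QuantumFields.YangMills.Theorems.BalabanUVNodesN18HLayerW1ConfigRecord
import Literature.MathematicalPhysics.QuantumFieldTheory.Balaban1983to89.Node00.HistoryRecursionOfRecord
import Literature.MathematicalPhysics.QuantumFieldTheory.Balaban1983to89.Node00.RateRecordW1MapsAdm

/-!
# BalabanUVNodes ∕ N18 — THE H-LAYER ESTIMATE FOR W1's GENERATED TOWERS: NODE A's majorant AS A PROPERTY OF ONE STEP GENERATOR — «older terms obeying
# (1.18) and analytic on the tables ⟹ the new activities analytic and (2.38)-bounded on the next table» — ⟹ by W1's RECURSION both inductive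
# assumptions for every generated term at every complex history in `D`, W1's `RecAdmissible` DISCHARGED, (1.18) + [I] p. 263 analyticity + the
# (2.38) pair for `toClusterTower G` and its run-length truncations, L05 at the admissible pairing of record (Track A, DAG node N18 = NE5
# `T4OutputRate.NE5 EA EB W κ θ C₅` :211; cluster K4 «SpineRates»; file 17 of seat pub-ymgap-dag-n18-c, row s1, generation 4)

Cell `pub-ymgap`, HUMAN RULING D-0062 (Track A), seat `pub-ymgap-dag-n18-c` (s1), generation 4.  THEOREMS ONLY (no `def`, no `instance`, no `sorry`); imports file 10
`…N18HLayerW1ConfigRecord` (p474817), node00-def-W1 g4's `Node00/HistoryRecursionOfRecord` (p481041: `StepGen`, `GenTower`, `recTerm`, `toClusterTower`,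
`truncRun`, `RecAdmissible`) and the admissible-slot pin `Node00/RateRecordW1MapsAdm` (p481475); restates nothing.

WHY.  Files 15–16 (`…N18HLayerW1Induction(Terms)`) run [I] Theorem 1's induction for an ABSTRACT tower `S : W1.ClusterTower` with the one step displayed
as a property of the tower («inductive assumptions at the levels ≤ k ⟹ the step-k pair»).  At W1's history-dependence OBJECT the terms are GENERATED:
`recTerm G g (k+1) X φ = (G k).E (g k) (olderOf (recTerm G g) k) φ X` — the step-`k` generator `G k : StepGen` reads the LAST coupling and the OLDER TERMS
`(E^{(j)})_{j ≤ k}` and nothing else ([I] (2.12)–(2.13) p. 268, [II] (1.41) + (2.14): BY CONSTRUCTION, node00-def-W1's `recTerm_succ`).  There the printed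
one step is a property of ONE GENERATOR, with no tower and no induction in it — exactly the shape in which [II] states and proves it («for V_k obeying
(1.42)–(1.43) [assembled from older terms obeying (1.18)] the terms (2.14) are analytic on U^c_{k+1} and obey (2.26), hence (2.38)»):
  (GEN)_k  for every last coupling `t ∈ D` and every older-term table `old` obeying (1.18)`(E₀, r₁)` on the tables `sp j`, `j ≤ k`, and analytic there,
           the activities `φ ↦ (G k).H t old φ Z` are analytic at the points of `sp (k+1) Z` and `‖(G k).H t old φ Z‖ ≤ A·e^{−R d_{k+1}(Z)}` there.
THIS FILE: (GEN) at every step ⟹ — by strong induction on W1's recursion and file 10's per-level tool (neighbourhood extension + NE1′ at `Φ := CPair`, ANY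
restriction-closed table, STRICT [KP86] clause, renewal `e·9·64·K₀(64,8)²·A ≤ E₀`) — both inductive assumptions for EVERY generated term at EVERY complex
history in `D`; hence node00-def-W1's `RecAdmissible` (a HYPOTHESIS of its `analyticInEach_recTerm`) is DISCHARGED for the natural admissible class; and on
the real reading `toClusterTower G`: (1.18), [I] p. 263 analyticity, the (2.38) pair at every step, run-length truncations, L05 ∕ L06 at the admissible pairing.

WHAT (theorems only; `F.P K`, d = 4 numerals; coefficient algebra `𝔸 : Type*`).
* §1 ★ `recTerm_inductiveAssumptions_of_stepGen` — (GEN) at every step + `W1.SpRestr` at every positive level + clauses + renewal ⟹ for every `g : ℕ → ℂ`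
  with values in `D`, every level `j`, domain `X`: `‖recTerm G g j X φ‖ ≤ E₀·e^{−r₁ d_j(X)}` on `sp j X` and `AnalyticOnNhd ℂ (recTerm G g j X) (sp j X)`
  (level 0: no term; level `k+1`: (GEN)_k at `t = g k`, `old = olderOf (recTerm G g) k` fed with the induction hypothesis, then file 10 on the one-step
  data `⟨Idx, idx, T · (g k) old⟩` whose (2.13) IS `recTerm G g (k+1) X` by `recTerm_succ`).
* §2 ★ `recAdmissible_of_stepGen` — node00-def-W1's `RecAdmissible G D (k ↦ {old | (1.18)(E₀,r₁) ∧ analytic on the tables})` PROVED from (GEN) (so its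
  `analyticInEach_recTerm` ∕ `analyticInEachOfRecord_toClusterTower` run with `hAdm` discharged, given (A-last) ∕ (A-prop)).
* §3 THE REAL READING: `termBound118_toClusterTower_of_stepGen` ((1.18) `W1.TermBound118 (toClusterTower G) W sp E₀ r₁` for histories read inside `D`),
  `termAnalytic_toClusterTower_of_stepGen` ([I] p. 263), ★ `hLayer_toClusterTower_of_stepGen` (the pair `(toClusterTower G k).AnalyticH (box γ k) (sp (k+1))
  ∧ .Bound238 (box γ k) (sp (k+1)) A R` AT EVERY STEP, `]0, γ]` read inside `D` — the `han ∕ h238` of files 9–13 and of dag-n18-d's junctions, PRODUCED),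
  `termBound118_truncRun_toClusterTower_of_stepGen` (run length `K′`: node00-def-W1's `termBound118_truncRun`).
* §4 ★ `decayBound_EA_ofRecordAdm_toClusterTower_of_stepGen` ∕ ★ `decayBound_EB_ofRecordAdm_toClusterTower_of_stepGen` — L05 ∕ L06 of the END AT THE ADMISSIBLE
  PAIRING OF RECORD for generated run-A ∕ run-B towers from (GEN) + restriction property + numerics ALONE (readings in the spaces BY TYPE — n22-c's
  `decayBound_functionalOn_of_termBound118` ∕ `LevelPairing.ofRecordAdm_embB_mem`; the pairing of record preserves `d_j` — `W1.dj_pairOfRecord`).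
* §5 `stepGen_termless` — (GEN) is satisfiable (A5): the generator with no indices carries it (junk-shaped witness, labelled so).
HONEST FRAMING — what this is NOT.  Count-neutral by-name knit AT THE OBJECT; NOT a discharge of N18 (typed 28∕28 · discharged 5∕27 UNCHANGED).  (GEN) is
DISPLAYED and asserted nowhere: at REAL last couplings (`D := ↑]0, γ]`, all that §2–§3 use via `hD`) it is [II] (2.14)–(2.38) for THE generator of record
(N10's Lemmas 1–3 ∕ NODE A's majorant, the (1.41) factorisation inside `T`); for an OPEN `D ⊂ ℂ` it includes the last-coupling complexification ([I] p. 263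
«(or analytic)», the N22 ∕ N09 lanes), NOT [II] as printed; `G`, `D`, the tables and the letters are data.  NE5 (two-run content) untouched: NOT IN PRINT,
NOT PROVED.  One finite 𝕋⁴ programme at fixed `ε` — NOT the continuum limit on ℝ⁴, NOT infinite volume, NOT OS, NOT a mass gap, NOT Clay.  0 `sorry`, 0 `def`.
References (TYPES ∕ loci only): [I] = [Balaban1987RG1] CMP **109** (1987) — (0.23)–(0.25) pp. 256–257, Thm 1 p. 259, (1.18) + analyticity p. 263, (2.12)–(2.13)
p. 268; [II] = [Balaban1988RG2Cluster] CMP **116** (1988) — p. 1, (1.41)–(1.43) p. 11, (2.13)–(2.14) pp. 14–15, (2.26) p. 17, Lemma 3 (2.38) p. 20, (2.41) p. 21,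
p. 22; [KoteckyPreiss1986] Thm 1 p. 492.  Nothing here is a claim about the Yang–Mills mass gap.
-/

noncomputable section

namespace Summit.QuantumFields.YangMills.BalabanUVNodes.N18HLayerW1Recursion

open Set Metric
open scoped BigOperators
open Literature.MathematicalPhysics.QuantumFieldTheory.Balaban1983to89
open Literature.MathematicalPhysics.QuantumFieldTheory.Balaban1983to89.T4Continuum (T4Family)
open Literature.MathematicalPhysics.QuantumFieldTheory.Balaban1983to89.T4OutputRate
open Literature.MathematicalPhysics.QuantumFieldTheory.Balaban1983to89.B12TreeDecay (K₀)
open Literature.MathematicalPhysics.QuantumFieldTheory.Balaban1983to89.Node00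
open Literature.MathematicalPhysics.QuantumFieldTheory.Balaban1983to89.Node00.Sect2 (domSys CPair ofBackgroundC)
open Literature.MathematicalPhysics.QuantumFieldTheory.Balaban1983to89.Node00.W1
open Summit.QuantumFields.YangMills.BalabanUVNodes.N18HLayerW1Config (prependCoupling_mem_window)
open Summit.QuantumFields.YangMills.BalabanUVNodes.N18HLayerW1ConfigRecord (analyticOnNhd_and_bound_E_of_bound238_table_four)
open YMDAG.N22.W1 (decayBound_functionalOn_of_termBound118)

/-! ## §1 (GEN) at every step ⟹ both inductive assumptions for every generated term, every complex history in `D` -/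

section Generated

variable (F : T4Family) (K : ℕ) {𝔸 : Type*} [NormedRing 𝔸] [NormedAlgebra ℂ 𝔸] {M : ℕ}

open Classical in
/-- **★ [I] THEOREM 1's INDUCTION ON W1's RECURSION FROM THE PER-GENERATOR SCHEMA (GEN).**  For a generator tower `G` on the record's torus `F.P K`, a coupling
domain `D ⊂ ℂ`, a space-table family `sp` with the restriction property of [II] p. 15 at every positive level (ANY; no openness), letters `E₀, r₁, A, R`:
IF (GEN) holds at every step `k` — for every last coupling `t ∈ D` and every older-term table `old : W1.OlderTerms … k` obeying (1.18)`(E₀, r₁)` on the tables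
`sp j`, `j ≤ k`, and analytic there, the new activities `φ ↦ (G k).H t old φ Z` are analytic at the points of `sp (k+1) Z` and obey (2.38)
`‖(G k).H t old φ Z‖ ≤ A·e^{−R d_{k+1}(Z)}` there ([II] (2.14)–(2.26) + Lemma 3 for THE generator of record; DISPLAYED) — THEN, under the located rate clause,
the STRICT [KP86] clause and the renewal `e·9·64·K₀(64,8)²·A ≤ E₀`, EVERY GENERATED TERM at EVERY coupling history `g` with values in `D` satisfies both
inductive assumptions: `‖recTerm G g j X φ‖ ≤ E₀·e^{−r₁ d_j(X)}` for `φ ∈ sp j X`, and `recTerm G g j X` is analytic at every point of `sp j X`.  Strong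
induction on the level: level `0` carries no term ([I] (0.23)); at level `k+1`, `recTerm_succ` displays the term as the one-step map at `(g k, olderOf
(recTerm G g) k)`, (GEN)_k fed with the induction hypothesis gives the pair for these activities, and file 10's `analyticOnNhd_and_bound_E_of_bound238_table_four`
— run on the one-step cluster data `⟨Idx, idx, i ↦ T i (g k) old⟩` whose (2.13) IS that term — gives (2.39)–(2.41) and the analyticity, renewed to `E₀`.
[cite: Balaban1987RG1, Thm 1 p.259, (1.18) p.263 and (2.12)-(2.13) p.268; Balaban1988RG2Cluster, p.1, (2.14) p.15, Lemma 3 (2.38) p.20, (2.41) p.21, p.22] -/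
theorem recTerm_inductiveAssumptions_of_stepGen (G : GenTower (F.P K) 𝔸 M) (D : Set ℂ)
    (sp : (j : ℕ) → (domSys (F.P K) M j).Dom → Set (CPair (F.P K) 𝔸)) {A R r₁ E₀ : ℝ} (hrestr : ∀ k, W1.SpRestr (sp (k + 1)))
    (hgen : ∀ k : ℕ, ∀ t ∈ D, ∀ old : OlderTerms (F.P K) 𝔸 M k,
      (∀ (j : Fin (k + 1)) (Y : (domSys (F.P K) M j).Dom), ∀ ψ ∈ sp j Y,
          ‖old j Y ψ‖ ≤ E₀ * Real.exp (-(r₁ * (domSys (F.P K) M j).dj Y))) →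
      (∀ (j : Fin (k + 1)) (Y : (domSys (F.P K) M j).Dom), AnalyticOnNhd ℂ (old j Y) (sp j Y)) →
      (∀ Z : (domSys (F.P K) M (k + 1)).Dom, AnalyticOnNhd ℂ (fun φ => (G k).H t old φ Z) (sp (k + 1) Z)) ∧
      (∀ (Z : (domSys (F.P K) M (k + 1)).Dom), ∀ φ ∈ sp (k + 1) Z,
          ‖(G k).H t old φ Z‖ ≤ A * Real.exp (-(R * (domSys (F.P K) M (k + 1)).dj Z))))
    (hA : 0 ≤ A) (hr₁ : 0 ≤ r₁) (hrate : r₁ + 2 * (64 * Real.log 162) + 2 ≤ R)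
    (hsmall : A * Real.exp (5 * r₁ + 1) * K₀ 64 8 * 9 * 64 < 1) (hrenew : Real.exp 1 * 9 * 64 * K₀ 64 8 ^ 2 * A ≤ E₀)
    (g : ℕ → ℂ) (hg : ∀ n, g n ∈ D) :
    ∀ (j : ℕ) (X : (domSys (F.P K) M j).Dom),
      (∀ φ ∈ sp j X, ‖recTerm G g j X φ‖ ≤ E₀ * Real.exp (-(r₁ * (domSys (F.P K) M j).dj X))) ∧
      AnalyticOnNhd ℂ (recTerm G g j X) (sp j X) := by
  have hM : 0 ≤ Real.exp 1 * 9 * 64 * K₀ 64 8 ^ 2 * A := by positivity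
  have hE₀ : 0 ≤ E₀ := le_trans hM hrenew
  intro j
  induction j using Nat.strong_induction_on with
  | _ j ih =>
    intro X
    cases j with
    | zero =>
      have h0 : recTerm G g 0 X = fun _ => 0 := funext fun φ => recTerm_zero G g X φ
      refine ⟨fun φ _ => ?_, ?_⟩
      · rw [recTerm_zero, norm_zero]; positivity
      · rw [h0]; exact analyticOnNhd_const
    | succ k =>
      -- (GEN)_k at the last coupling `g k` and the generated older terms, fed with the induction hypothesis
      obtain ⟨han, h238⟩ := hgen k (g k) (hg k) (olderOf (recTerm G g) k)
        (fun j' Y ψ hψ => (ih j'.1 j'.2 Y).1 ψ hψ) (fun j' Y => (ih j'.1 j'.2 Y).2)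
      -- file 10 on the one-step cluster data `⟨Idx, idx, i ↦ T i (g k) old⟩` (young prefix inert), any restriction-closed table
      have key := analyticOnNhd_and_bound_E_of_bound238_table_four F K
        (⟨(G k).Idx, (G k).idx, fun i _ φ => (G k).T i (g k) (olderOf (recTerm G g) k) φ⟩ : ClusterStep (F.P K) 𝔸 M k)
        (Set.univ : Set (Fin (k + 1) → ℝ)) (sp (k + 1)) (hrestr k) (fun _ _ Z => han Z) (fun _ _ Z φ hφ => h238 Z φ hφ) hA hr₁ hrate
        hsmall (fun _ => 0) (Set.mem_univ _) X
      have hE : recTerm G g (k + 1) X = fun φ =>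
          (⟨(G k).Idx, (G k).idx, fun i _ φ => (G k).T i (g k) (olderOf (recTerm G g) k) φ⟩ : ClusterStep (F.P K) 𝔸 M k).E
            (fun _ => 0) φ X :=
        funext fun φ => recTerm_succ G g k X φ
      refine ⟨fun φ hφ => ?_, ?_⟩
      · rw [hE]
        exact (key.2 φ hφ).trans (mul_le_mul_of_nonneg_right hrenew (Real.exp_nonneg _))
      · rw [hE]
        exact key.1

open Classical in
/-- **★ node00-def-W1's ADMISSIBILITY BOOKKEEPING `RecAdmissible` DISCHARGED FROM (GEN)**: along every coupling history with values in `D`, the generated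
older terms of every step lie in the admissible class «(1.18)`(E₀, r₁)` on the tables and analytic there» — the hypothesis `hAdm` of
`W1.analyticInEach_recTerm` ∕ `W1.analyticInEachOfRecord_toClusterTower` («an OUTPUT of the construction, here a hypothesis schema») PROVED for this class, so
ROAD 3's coupling-analyticity induction runs with (A-last) ∕ (A-prop) as its only schemas once (GEN) is supplied. [cite: Balaban1987RG1, §1 p.263 (the inductive assumptions) and Thm 1 p.259; Balaban1988RG2Cluster, p.22] -/
theorem recAdmissible_of_stepGen (G : GenTower (F.P K) 𝔸 M) (D : Set ℂ)
    (sp : (j : ℕ) → (domSys (F.P K) M j).Dom → Set (CPair (F.P K) 𝔸)) {A R r₁ E₀ : ℝ} (hrestr : ∀ k, W1.SpRestr (sp (k + 1)))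
    (hgen : ∀ k : ℕ, ∀ t ∈ D, ∀ old : OlderTerms (F.P K) 𝔸 M k,
      (∀ (j : Fin (k + 1)) (Y : (domSys (F.P K) M j).Dom), ∀ ψ ∈ sp j Y,
          ‖old j Y ψ‖ ≤ E₀ * Real.exp (-(r₁ * (domSys (F.P K) M j).dj Y))) →
      (∀ (j : Fin (k + 1)) (Y : (domSys (F.P K) M j).Dom), AnalyticOnNhd ℂ (old j Y) (sp j Y)) →
      (∀ Z : (domSys (F.P K) M (k + 1)).Dom, AnalyticOnNhd ℂ (fun φ => (G k).H t old φ Z) (sp (k + 1) Z)) ∧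
      (∀ (Z : (domSys (F.P K) M (k + 1)).Dom), ∀ φ ∈ sp (k + 1) Z,
          ‖(G k).H t old φ Z‖ ≤ A * Real.exp (-(R * (domSys (F.P K) M (k + 1)).dj Z))))
    (hA : 0 ≤ A) (hr₁ : 0 ≤ r₁) (hrate : r₁ + 2 * (64 * Real.log 162) + 2 ≤ R)
    (hsmall : A * Real.exp (5 * r₁ + 1) * K₀ 64 8 * 9 * 64 < 1) (hrenew : Real.exp 1 * 9 * 64 * K₀ 64 8 ^ 2 * A ≤ E₀) :
    RecAdmissible G D fun k => {old : OlderTerms (F.P K) 𝔸 M k |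
      (∀ (j : Fin (k + 1)) (Y : (domSys (F.P K) M j).Dom), ∀ ψ ∈ sp j Y,
          ‖old j Y ψ‖ ≤ E₀ * Real.exp (-(r₁ * (domSys (F.P K) M j).dj Y))) ∧
      (∀ (j : Fin (k + 1)) (Y : (domSys (F.P K) M j).Dom), AnalyticOnNhd ℂ (old j Y) (sp j Y))} :=
  fun g hg _ =>
    ⟨fun j Y ψ hψ => (recTerm_inductiveAssumptions_of_stepGen F K G D sp hrestr hgen hA hr₁ hrate hsmall hrenew g hg j.1 Y).1 ψ hψ,
      fun j Y => (recTerm_inductiveAssumptions_of_stepGen F K G D sp hrestr hgen hA hr₁ hrate hsmall hrenew g hg j.1 Y).2⟩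

end Generated

/-! ## §2 THE REAL READING `toClusterTower G`: (1.18), [I] p. 263 analyticity, the (2.38) pair at every step, run-length truncations -/

section RealReading

variable (F : T4Family) (K : ℕ) {𝔸 : Type*} [NormedRing 𝔸] [NormedAlgebra ℂ 𝔸] {M : ℕ}

open Classical in
/-- **(1.18) FOR THE GENERATED TOWER FROM (GEN)**: `W1.TermBound118 (toClusterTower G) W sp E₀ r₁` for every history set `W` read inside `D`
(`W1.termC_toClusterTower`: the terms of the generated tower ARE the generated terms at `↑g`). [cite: Balaban1987RG1, (1.18) p.263 and Thm 1 p.259; Balaban1988RG2Cluster, (2.41) p.21 and p.22] -/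
theorem termBound118_toClusterTower_of_stepGen (G : GenTower (F.P K) 𝔸 M) (D : Set ℂ)
    (sp : (j : ℕ) → (domSys (F.P K) M j).Dom → Set (CPair (F.P K) 𝔸)) {A R r₁ E₀ : ℝ} (hrestr : ∀ k, W1.SpRestr (sp (k + 1)))
    (hgen : ∀ k : ℕ, ∀ t ∈ D, ∀ old : OlderTerms (F.P K) 𝔸 M k,
      (∀ (j : Fin (k + 1)) (Y : (domSys (F.P K) M j).Dom), ∀ ψ ∈ sp j Y,
          ‖old j Y ψ‖ ≤ E₀ * Real.exp (-(r₁ * (domSys (F.P K) M j).dj Y))) →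
      (∀ (j : Fin (k + 1)) (Y : (domSys (F.P K) M j).Dom), AnalyticOnNhd ℂ (old j Y) (sp j Y)) →
      (∀ Z : (domSys (F.P K) M (k + 1)).Dom, AnalyticOnNhd ℂ (fun φ => (G k).H t old φ Z) (sp (k + 1) Z)) ∧
      (∀ (Z : (domSys (F.P K) M (k + 1)).Dom), ∀ φ ∈ sp (k + 1) Z,
          ‖(G k).H t old φ Z‖ ≤ A * Real.exp (-(R * (domSys (F.P K) M (k + 1)).dj Z))))
    (hA : 0 ≤ A) (hr₁ : 0 ≤ r₁) (hrate : r₁ + 2 * (64 * Real.log 162) + 2 ≤ R)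
    (hsmall : A * Real.exp (5 * r₁ + 1) * K₀ 64 8 * 9 * 64 < 1) (hrenew : Real.exp 1 * 9 * 64 * K₀ 64 8 ^ 2 * A ≤ E₀)
    (W : Set (ℕ → ℝ)) (hW : ∀ g ∈ W, ∀ n, ((g n : ℝ) : ℂ) ∈ D) :
    TermBound118 (toClusterTower G) W sp E₀ r₁ := fun g hgW j X φ hφ => by
  rw [termC_toClusterTower]
  exact (recTerm_inductiveAssumptions_of_stepGen F K G D sp hrestr hgen hA hr₁ hrate hsmall hrenew _ (hW g hgW) j X).1 φ hφ

open Classical in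
/-- **[I] p. 263 ANALYTICITY FOR THE GENERATED TOWER FROM (GEN)**: `W1.TermAnalytic (toClusterTower G) W sp`. [cite: Balaban1987RG1, §1 p.263 (analytic on U^c_j) and Thm 1 p.259; Balaban1988RG2Cluster, p.15 (analyticity statement)] -/
theorem termAnalytic_toClusterTower_of_stepGen (G : GenTower (F.P K) 𝔸 M) (D : Set ℂ)
    (sp : (j : ℕ) → (domSys (F.P K) M j).Dom → Set (CPair (F.P K) 𝔸)) {A R r₁ E₀ : ℝ} (hrestr : ∀ k, W1.SpRestr (sp (k + 1)))
    (hgen : ∀ k : ℕ, ∀ t ∈ D, ∀ old : OlderTerms (F.P K) 𝔸 M k,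
      (∀ (j : Fin (k + 1)) (Y : (domSys (F.P K) M j).Dom), ∀ ψ ∈ sp j Y,
          ‖old j Y ψ‖ ≤ E₀ * Real.exp (-(r₁ * (domSys (F.P K) M j).dj Y))) →
      (∀ (j : Fin (k + 1)) (Y : (domSys (F.P K) M j).Dom), AnalyticOnNhd ℂ (old j Y) (sp j Y)) →
      (∀ Z : (domSys (F.P K) M (k + 1)).Dom, AnalyticOnNhd ℂ (fun φ => (G k).H t old φ Z) (sp (k + 1) Z)) ∧
      (∀ (Z : (domSys (F.P K) M (k + 1)).Dom), ∀ φ ∈ sp (k + 1) Z,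
          ‖(G k).H t old φ Z‖ ≤ A * Real.exp (-(R * (domSys (F.P K) M (k + 1)).dj Z))))
    (hA : 0 ≤ A) (hr₁ : 0 ≤ r₁) (hrate : r₁ + 2 * (64 * Real.log 162) + 2 ≤ R)
    (hsmall : A * Real.exp (5 * r₁ + 1) * K₀ 64 8 * 9 * 64 < 1) (hrenew : Real.exp 1 * 9 * 64 * K₀ 64 8 ^ 2 * A ≤ E₀)
    (W : Set (ℕ → ℝ)) (hW : ∀ g ∈ W, ∀ n, ((g n : ℝ) : ℂ) ∈ D) :
    TermAnalytic (toClusterTower G) W sp := fun g hgW j X => by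
  have h : termC (toClusterTower G) j X g = recTerm G (fun n => ((g n : ℝ) : ℂ)) j X :=
    funext fun φ => termC_toClusterTower G g j X φ
  rw [h]
  exact (recTerm_inductiveAssumptions_of_stepGen F K G D sp hrestr hgen hA hr₁ hrate hsmall hrenew _ (hW g hgW) j X).2

open Classical in
/-- **★ THE (2.38) PAIR AT EVERY STEP OF THE GENERATED TOWER, PRODUCED** — the per-step hypotheses `han ∕ h238 : ∀ k, (S k).AnalyticH (box γ k) (sp (k+1)) ∧
(S k).Bound238 (box γ k) (sp (k+1)) A R` of files 9–13 and of dag-n18-d's N18 junctions, at `S := toClusterTower G`, from (GEN) alone (with the window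
`]0, γ]` read inside `D`): at a young prefix `gk ∈ ]0, γ]^{k+1}` the generated step's activity IS the generator's at the last coupling `gk k` and the older
terms generated from `gk` (`W1.toClusterTower_H`), which — read at the history `n ↦ gk (min n k)` with values in `D` (`W1.recTerm_congr_prefix`: the levels
`≤ k` never read beyond) — obey both inductive assumptions by §1. [cite: Balaban1988RG2Cluster, p.15 (analyticity statement) and Lemma 3 (2.38) p.20; Balaban1987RG1, Thm 1 p.259 and (2.13) p.268] -/
theorem hLayer_toClusterTower_of_stepGen (G : GenTower (F.P K) 𝔸 M) (D : Set ℂ)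
    (sp : (j : ℕ) → (domSys (F.P K) M j).Dom → Set (CPair (F.P K) 𝔸)) {A R r₁ E₀ γ : ℝ} (hrestr : ∀ k, W1.SpRestr (sp (k + 1)))
    (hgen : ∀ k : ℕ, ∀ t ∈ D, ∀ old : OlderTerms (F.P K) 𝔸 M k,
      (∀ (j : Fin (k + 1)) (Y : (domSys (F.P K) M j).Dom), ∀ ψ ∈ sp j Y,
          ‖old j Y ψ‖ ≤ E₀ * Real.exp (-(r₁ * (domSys (F.P K) M j).dj Y))) →
      (∀ (j : Fin (k + 1)) (Y : (domSys (F.P K) M j).Dom), AnalyticOnNhd ℂ (old j Y) (sp j Y)) →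
      (∀ Z : (domSys (F.P K) M (k + 1)).Dom, AnalyticOnNhd ℂ (fun φ => (G k).H t old φ Z) (sp (k + 1) Z)) ∧
      (∀ (Z : (domSys (F.P K) M (k + 1)).Dom), ∀ φ ∈ sp (k + 1) Z,
          ‖(G k).H t old φ Z‖ ≤ A * Real.exp (-(R * (domSys (F.P K) M (k + 1)).dj Z))))
    (hA : 0 ≤ A) (hr₁ : 0 ≤ r₁) (hrate : r₁ + 2 * (64 * Real.log 162) + 2 ≤ R)
    (hsmall : A * Real.exp (5 * r₁ + 1) * K₀ 64 8 * 9 * 64 < 1) (hrenew : Real.exp 1 * 9 * 64 * K₀ 64 8 ^ 2 * A ≤ E₀)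
    (hD : ∀ s ∈ Ioc (0 : ℝ) γ, ((s : ℝ) : ℂ) ∈ D) :
    ∀ k, (toClusterTower G k).AnalyticH (box γ k) (sp (k + 1)) ∧ (toClusterTower G k).Bound238 (box γ k) (sp (k + 1)) A R := by
  intro k
  -- for a young prefix `gk` of the box: the history `n ↦ gk (min n k)` has values in `D` and generates the same older terms at the levels `≤ k`
  have holder : ∀ gk ∈ box γ k,
      olderOf (recTerm G (histOfPrefix gk)) k = olderOf (recTerm G fun n => ((gk ⟨min n k, by omega⟩ : ℝ) : ℂ)) k := by
    intro gk _
    funext j' Y ψ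
    refine recTerm_congr_prefix G j'.1 (fun i hi => ?_) Y ψ
    have hik : i < k + 1 := lt_trans hi j'.2
    rw [histOfPrefix_apply_lt gk hik]
    have : min i k = i := Nat.min_eq_left (by omega)
    simp only [this]
  have hvals : ∀ gk ∈ box γ k, ∀ n, ((gk ⟨min n k, by omega⟩ : ℝ) : ℂ) ∈ D :=
    fun gk hgk n => hD _ (hgk ⟨min n k, by omega⟩)
  have hlast : ∀ gk ∈ box γ k, ((gk (Fin.last k) : ℝ) : ℂ) ∈ D := fun gk hgk => hD _ (hgk (Fin.last k))
  -- (GEN)_k at the last coupling and these older terms, fed with §1 at that history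
  have hpair : ∀ gk ∈ box γ k,
      (∀ Z : (domSys (F.P K) M (k + 1)).Dom, AnalyticOnNhd ℂ
        (fun φ => (G k).H ((gk (Fin.last k) : ℝ) : ℂ) (olderOf (recTerm G (histOfPrefix gk)) k) φ Z) (sp (k + 1) Z)) ∧
      (∀ (Z : (domSys (F.P K) M (k + 1)).Dom), ∀ φ ∈ sp (k + 1) Z,
        ‖(G k).H ((gk (Fin.last k) : ℝ) : ℂ) (olderOf (recTerm G (histOfPrefix gk)) k) φ Z‖ ≤
          A * Real.exp (-(R * (domSys (F.P K) M (k + 1)).dj Z))) := by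
    intro gk hgk
    rw [holder gk hgk]
    exact hgen k _ (hlast gk hgk) _
      (fun j' Y ψ hψ => (recTerm_inductiveAssumptions_of_stepGen F K G D sp hrestr hgen hA hr₁ hrate hsmall hrenew _ (hvals gk hgk) j'.1 Y).1 ψ hψ)
      (fun j' Y => (recTerm_inductiveAssumptions_of_stepGen F K G D sp hrestr hgen hA hr₁ hrate hsmall hrenew _ (hvals gk hgk) j'.1 Y).2)
  refine ⟨fun gk hgk Z => ?_, fun gk hgk Z φ hφ => ?_⟩
  · have h : (fun φ => (toClusterTower G k).H gk φ Z) =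
        fun φ => (G k).H ((gk (Fin.last k) : ℝ) : ℂ) (olderOf (recTerm G (histOfPrefix gk)) k) φ Z :=
      funext fun φ => toClusterTower_H G k gk φ Z
    rw [h]
    exact (hpair gk hgk).1 Z
  · rw [toClusterTower_H]
    exact (hpair gk hgk).2 Z φ hφ

open Classical in
/-- **(1.18) FOR THE RUN-LENGTH TRUNCATIONS OF THE GENERATED TOWER** ([I] (0.23)–(0.24): the run of `K′` steps carries the terms of creation steps `≤ K′` only):
`W1.TermBound118 (truncRun K′ (toClusterTower G)) W sp E₀ r₁` — node00-def-W1's preservation face `termBound118_truncRun` on §2's (1.18).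
[cite: Balaban1987RG1, (0.23)-(0.24) pp.256-257 and (1.18) p.263] -/
theorem termBound118_truncRun_toClusterTower_of_stepGen (G : GenTower (F.P K) 𝔸 M) (D : Set ℂ)
    (sp : (j : ℕ) → (domSys (F.P K) M j).Dom → Set (CPair (F.P K) 𝔸)) {A R r₁ E₀ : ℝ} (hrestr : ∀ k, W1.SpRestr (sp (k + 1)))
    (hgen : ∀ k : ℕ, ∀ t ∈ D, ∀ old : OlderTerms (F.P K) 𝔸 M k,
      (∀ (j : Fin (k + 1)) (Y : (domSys (F.P K) M j).Dom), ∀ ψ ∈ sp j Y,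
          ‖old j Y ψ‖ ≤ E₀ * Real.exp (-(r₁ * (domSys (F.P K) M j).dj Y))) →
      (∀ (j : Fin (k + 1)) (Y : (domSys (F.P K) M j).Dom), AnalyticOnNhd ℂ (old j Y) (sp j Y)) →
      (∀ Z : (domSys (F.P K) M (k + 1)).Dom, AnalyticOnNhd ℂ (fun φ => (G k).H t old φ Z) (sp (k + 1) Z)) ∧
      (∀ (Z : (domSys (F.P K) M (k + 1)).Dom), ∀ φ ∈ sp (k + 1) Z,
          ‖(G k).H t old φ Z‖ ≤ A * Real.exp (-(R * (domSys (F.P K) M (k + 1)).dj Z))))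
    (hA : 0 ≤ A) (hr₁ : 0 ≤ r₁) (hrate : r₁ + 2 * (64 * Real.log 162) + 2 ≤ R)
    (hsmall : A * Real.exp (5 * r₁ + 1) * K₀ 64 8 * 9 * 64 < 1) (hrenew : Real.exp 1 * 9 * 64 * K₀ 64 8 ^ 2 * A ≤ E₀)
    (W : Set (ℕ → ℝ)) (hW : ∀ g ∈ W, ∀ n, ((g n : ℝ) : ℂ) ∈ D) (K' : ℕ) :
    TermBound118 (truncRun K' (toClusterTower G)) W sp E₀ r₁ :=
  have hM : 0 ≤ Real.exp 1 * 9 * 64 * K₀ 64 8 ^ 2 * A := by positivity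
  termBound118_truncRun (termBound118_toClusterTower_of_stepGen F K G D sp hrestr hgen hA hr₁ hrate hsmall hrenew W hW) (le_trans hM hrenew) K'

end RealReading

/-! ## §3 L05 ∕ L06 AT THE ADMISSIBLE PAIRING OF RECORD for generated towers: no embedding clause, no pairing clause, no per-step data -/

section Admissible

open scoped Matrix.Norms.L2Operator

variable (F : T4Family) (M N k : ℕ) (sp : (k j : ℕ) → (domSys (F.P k) M j).Dom → Set (CPair (F.P k) (MatA N)))
  (gauge : GaugeField (F.P k) 0 (Node00.SU N) → GaugeField (F.P k) 0 (Node00.SU N) → ℝ) (hg : ∀ U U', 0 ≤ gauge U U')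
  (T₀ : GaugeField (F.P (k + 1)) 0 (Node00.SU N) → GaugeField (F.P k) 0 (Node00.SU N))
  (hT₀ : ∀ U : GaugeField (F.P (k + 1)) 0 (Node00.SU N),
    (∀ (j : ℕ) (Y : (domSys (F.P (k + 1)) M j).Dom), ofBackgroundC (ιSU N) U ∈ sp (k + 1) j Y) →
      ∀ (j : ℕ) (Y : (domSys (F.P k) M j).Dom), ofBackgroundC (ιSU N) (T₀ U) ∈ sp k j Y)

open Classical in
/-- **★ L05 OF THE END AT THE ADMISSIBLE PAIRING OF RECORD FOR THE GENERATED TOWER, FROM (GEN) ALONE.**  Run A = the admissible `SU(N)` backgrounds of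
`F.P k` for the table family `sp` (readings `(ιU, 0)` in the spaces BY TYPE, `LevelPairing.ofRecordAdm_embA_mem`), run A's tower = `toClusterTower G` for a
generator tower `G` on `F.P k`: (GEN) on the tables `sp k`, their restriction property, the located clauses, the renewal and the window `]0, γ]` read inside
`D` ⟹ `DecayBound ((LevelPairing.ofRecordAdm F M N k sp gauge hg T₀ hT₀).EA (toClusterTower G)) (Window γ) E₀ r₁` — (1.18) read at the admissible
backgrounds for the GENERATED terms of record's shape (`LevelPairing.EA_eq` + n22-c's `decayBound_functionalOn_of_termBound118` on §2's (1.18)).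
[cite: Balaban1987RG1, (0.25) p.257, (1.18) p.263 and Thm 1 p.259; Balaban1988RG2Cluster, p.22] -/
theorem decayBound_EA_ofRecordAdm_toClusterTower_of_stepGen (G : GenTower (F.P k) (MatA N) M) (D : Set ℂ) {A R r₁ E₀ γ : ℝ}
    (hrestr : ∀ m, W1.SpRestr (sp k (m + 1)))
    (hgen : ∀ m : ℕ, ∀ t ∈ D, ∀ old : OlderTerms (F.P k) (MatA N) M m,
      (∀ (j : Fin (m + 1)) (Y : (domSys (F.P k) M j).Dom), ∀ ψ ∈ sp k j Y,
          ‖old j Y ψ‖ ≤ E₀ * Real.exp (-(r₁ * (domSys (F.P k) M j).dj Y))) →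
      (∀ (j : Fin (m + 1)) (Y : (domSys (F.P k) M j).Dom), AnalyticOnNhd ℂ (old j Y) (sp k j Y)) →
      (∀ Z : (domSys (F.P k) M (m + 1)).Dom, AnalyticOnNhd ℂ (fun φ => (G m).H t old φ Z) (sp k (m + 1) Z)) ∧
      (∀ (Z : (domSys (F.P k) M (m + 1)).Dom), ∀ φ ∈ sp k (m + 1) Z,
          ‖(G m).H t old φ Z‖ ≤ A * Real.exp (-(R * (domSys (F.P k) M (m + 1)).dj Z))))
    (hA : 0 ≤ A) (hr₁ : 0 ≤ r₁) (hrate : r₁ + 2 * (64 * Real.log 162) + 2 ≤ R)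
    (hsmall : A * Real.exp (5 * r₁ + 1) * K₀ 64 8 * 9 * 64 < 1) (hrenew : Real.exp 1 * 9 * 64 * K₀ 64 8 ^ 2 * A ≤ E₀)
    (hD : ∀ s ∈ Ioc (0 : ℝ) γ, ((s : ℝ) : ℂ) ∈ D) :
    DecayBound ((LevelPairing.ofRecordAdm F M N k sp gauge hg T₀ hT₀).EA (toClusterTower G)) (Window γ) E₀ r₁ := by
  rw [LevelPairing.EA_eq]
  exact decayBound_functionalOn_of_termBound118 (toClusterTower G) _ _ (sp k)
    (fun j U X => LevelPairing.ofRecordAdm_embA_mem F M N k sp gauge hg T₀ hT₀ U j X)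
    (termBound118_toClusterTower_of_stepGen F k G D (sp k) hrestr hgen hA hr₁ hrate hsmall hrenew (Window γ)
      fun g hgW n => hD _ (hgW n))

open Classical in
/-- **★ L06 OF THE END AT THE ADMISSIBLE PAIRING OF RECORD FOR A GENERATED RUN-B TOWER, FROM (GEN) ALONE.**  Run B = the admissible backgrounds of `F.P (k+1)`
(readings in the spaces BY TYPE, `LevelPairing.ofRecordAdm_embB_mem`), the domain pairing IS `W1.pairOfRecord`, which PRESERVES `d_j` (`W1.dj_pairOfRecord`),
run B's tower = `toClusterTower G′` for a generator tower `G′` on `F.P (k+1)`: (GEN) for `G′` on the tables `sp (k+1)`, their restriction property, the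
clauses, the renewal and `]0, γ]` read inside `D` ⟹ for every member `b ∈ ]0, γ]`, `DecayBound ((LevelPairing.ofRecordAdm …).EB (toClusterTower G′) b)
(Window γ) E₀ r₁` (§2's (1.18) at the history `b∷g`, file 9's `prependCoupling_mem_window`). [cite: Balaban1987RG1, (0.24)-(0.25) p.257, (1.18) p.263 and Thm 1 p.259; Balaban1988RG2Cluster, p.22] -/
theorem decayBound_EB_ofRecordAdm_toClusterTower_of_stepGen (G' : GenTower (F.P (k + 1)) (MatA N) M) (D : Set ℂ) {A R r₁ E₀ γ : ℝ}
    (hrestr : ∀ m, W1.SpRestr (sp (k + 1) (m + 1)))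
    (hgen : ∀ m : ℕ, ∀ t ∈ D, ∀ old : OlderTerms (F.P (k + 1)) (MatA N) M m,
      (∀ (j : Fin (m + 1)) (Y : (domSys (F.P (k + 1)) M j).Dom), ∀ ψ ∈ sp (k + 1) j Y,
          ‖old j Y ψ‖ ≤ E₀ * Real.exp (-(r₁ * (domSys (F.P (k + 1)) M j).dj Y))) →
      (∀ (j : Fin (m + 1)) (Y : (domSys (F.P (k + 1)) M j).Dom), AnalyticOnNhd ℂ (old j Y) (sp (k + 1) j Y)) →
      (∀ Z : (domSys (F.P (k + 1)) M (m + 1)).Dom, AnalyticOnNhd ℂ (fun φ => (G' m).H t old φ Z) (sp (k + 1) (m + 1) Z)) ∧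
      (∀ (Z : (domSys (F.P (k + 1)) M (m + 1)).Dom), ∀ φ ∈ sp (k + 1) (m + 1) Z,
          ‖(G' m).H t old φ Z‖ ≤ A * Real.exp (-(R * (domSys (F.P (k + 1)) M (m + 1)).dj Z))))
    (hA : 0 ≤ A) (hr₁ : 0 ≤ r₁) (hrate : r₁ + 2 * (64 * Real.log 162) + 2 ≤ R)
    (hsmall : A * Real.exp (5 * r₁ + 1) * K₀ 64 8 * 9 * 64 < 1) (hrenew : Real.exp 1 * 9 * 64 * K₀ 64 8 ^ 2 * A ≤ E₀)
    (hD : ∀ s ∈ Ioc (0 : ℝ) γ, ((s : ℝ) : ℂ) ∈ D) {b : ℝ} (hb : b ∈ Ioc (0 : ℝ) γ) :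
    DecayBound ((LevelPairing.ofRecordAdm F M N k sp gauge hg T₀ hT₀).EB (toClusterTower G') b) (Window γ) E₀ r₁ := by
  have h118 := termBound118_toClusterTower_of_stepGen F (k + 1) G' D (sp (k + 1)) hrestr hgen hA hr₁ hrate hsmall hrenew (Window γ)
    fun g hgW n => hD _ (hgW n)
  have hM : 0 ≤ Real.exp 1 * 9 * 64 * K₀ 64 8 ^ 2 * A := by positivity
  have hE₀ : 0 ≤ E₀ := le_trans hM hrenew
  intro g hgW U X
  have h := h118 (prependCoupling b g) (prependCoupling_mem_window hb hgW)
    ((LevelPairing.ofRecordAdm F M N k sp gauge hg T₀ hT₀).pair X).1 ((LevelPairing.ofRecordAdm F M N k sp gauge hg T₀ hT₀).pair X).2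
    ((LevelPairing.ofRecordAdm F M N k sp gauge hg T₀ hT₀).embB U)
    (LevelPairing.ofRecordAdm_embB_mem F M N k sp gauge hg T₀ hT₀ U _ _)
  have hpair : (domSys (F.P k) M X.1).dj X.2 ≤
      (domSys (F.P (k + 1)) M ((LevelPairing.ofRecordAdm F M N k sp gauge hg T₀ hT₀).pair X).1).dj
        ((LevelPairing.ofRecordAdm F M N k sp gauge hg T₀ hT₀).pair X).2 :=
    (dj_pairOfRecord F M k X).symm.le
  rw [LevelPairing.EB_apply, LevelPairing.carriers_d]
  calc |(functionalC (toClusterTower G') (prependCoupling b g) ((LevelPairing.ofRecordAdm F M N k sp gauge hg T₀ hT₀).embB U)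
          ((LevelPairing.ofRecordAdm F M N k sp gauge hg T₀ hT₀).pair X)).re|
      ≤ ‖functionalC (toClusterTower G') (prependCoupling b g) ((LevelPairing.ofRecordAdm F M N k sp gauge hg T₀ hT₀).embB U)
          ((LevelPairing.ofRecordAdm F M N k sp gauge hg T₀ hT₀).pair X)‖ := Complex.abs_re_le_norm _
    _ ≤ E₀ * Real.exp (-(r₁ * (domSys (F.P (k + 1)) M ((LevelPairing.ofRecordAdm F M N k sp gauge hg T₀ hT₀).pair X).1).dj
          ((LevelPairing.ofRecordAdm F M N k sp gauge hg T₀ hT₀).pair X).2)) := h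
    _ ≤ E₀ * Real.exp (-(r₁ * (domSys (F.P k) M X.1).dj X.2)) :=
        mul_le_mul_of_nonneg_left (Real.exp_le_exp.2 (neg_le_neg (mul_le_mul_of_nonneg_left hpair hr₁))) hE₀

end Admissible

/-! ## §4 (GEN) is satisfiable (A5 rider) -/

section Rider

variable {P : Params} {𝔸 : Type*} [NormedRing 𝔸] [NormedAlgebra ℂ 𝔸] {M : ℕ}

/-- **(GEN) IS SATISFIABLE (A5 rider)**: a generator with NO indices (`idx Z = ∅`, so every activity is the empty sum `0`) carries (GEN) for every `A ≥ 0`,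
every rate, every coupling domain and every antecedent — so §1–§3 are not vacuous implications.  A junk-shaped witness, labelled so: NOT NODE 00's
generator (ref-H WATCH-W1-DEGENERATE — content lives only in generators pinned to the (2.14) terms of record). [folklore] -/
theorem stepGen_termless (D : Set ℂ) (sp : (j : ℕ) → (domSys P M j).Dom → Set (CPair P 𝔸)) {A R r₁ E₀ : ℝ} (hA : 0 ≤ A)
    (T : (k : ℕ) → PEmpty → ℂ → OlderTerms P 𝔸 M k → CPair P 𝔸 → ℂ) :
    ∀ k : ℕ, ∀ t ∈ D, ∀ old : OlderTerms P 𝔸 M k,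
      (∀ (j : Fin (k + 1)) (Y : (domSys P M j).Dom), ∀ ψ ∈ sp j Y,
          ‖old j Y ψ‖ ≤ E₀ * Real.exp (-(r₁ * (domSys P M j).dj Y))) →
      (∀ (j : Fin (k + 1)) (Y : (domSys P M j).Dom), AnalyticOnNhd ℂ (old j Y) (sp j Y)) →
      (∀ Z : (domSys P M (k + 1)).Dom, AnalyticOnNhd ℂ
          (fun φ => (⟨PEmpty, fun _ => ∅, T k⟩ : StepGen P 𝔸 M k).H t old φ Z) (sp (k + 1) Z)) ∧
      (∀ (Z : (domSys P M (k + 1)).Dom), ∀ φ ∈ sp (k + 1) Z,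
          ‖(⟨PEmpty, fun _ => ∅, T k⟩ : StepGen P 𝔸 M k).H t old φ Z‖ ≤ A * Real.exp (-(R * (domSys P M (k + 1)).dj Z))) := by
  intro k t _ old _ _
  have h0 : ∀ (φ : CPair P 𝔸) (Z : (domSys P M (k + 1)).Dom), (⟨PEmpty, fun _ => ∅, T k⟩ : StepGen P 𝔸 M k).H t old φ Z = 0 :=
    fun φ Z => Finset.sum_empty
  refine ⟨fun Z => ?_, fun Z φ _ => ?_⟩
  · have h : (fun φ => (⟨PEmpty, fun _ => ∅, T k⟩ : StepGen P 𝔸 M k).H t old φ Z) = fun _ => (0 : ℂ) := funext fun φ => h0 φ Z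
    rw [h]
    exact analyticOnNhd_const
  · rw [h0, norm_zero]
    positivity

end Rider

end Summit.QuantumFields.YangMills.BalabanUVNodes.N18HLayerW1Recursion

end
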